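import Literature.NumberTheory.DiophantineGeometry.GeneralizedFermatTwoPowerCoefficientMazurTorsionProofs
import Literature.NumberTheory.EllipticCurves.MazurTorsionProofs
import Literature.NumberTheory.EllipticCurves.MazurTorsionSplit
import Literature.NumberTheory.EllipticCurves.KubertTwoTenProofs
import Literature.NumberTheory.EllipticCurves.KubertTwoTwelveProofs
import HarnessLib

/-!
# Ribet 1997, Theorem 3 from `khare_wintenberger` and the three remaining LEAVES of Mazur's
# torsion theorem

Topic `Literature/NumberTheory/DiophantineGeometry`; a further sibling *proofs* file (theorems
only: no definition, no named fact, no `sorry`) of `GeneralizedFermatTwoPowerCoefficient` (named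
fact `ribet1997_twoPowerFermat`: K. Ribet, *On the equation `aᵖ + 2^α bᵖ + cᵖ = 0`*, Acta Arith.
79 (1997), Thm. 3).

The sibling `…MazurTorsionProofs` proved Theorem 3 from Serre's conjecture (`khare_wintenberger`,
Khare–Wintenberger 2009, Thm. 1.2 with Thm. 9.1) and Mazur's torsion theorem in the form
`∀ V, mazur_torsion V` (Mazur 1977, Thm. (8)), the latter being the input `[14]` of Ribet's
Prop. 1.  In the tree, `mazur_torsion W` is itself assembled (`mazur_torsion_of_printed_leaves`,
`MazurTorsionProofs`) from five printed leaves, two of which are now theorems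
(`Kubert1976_no_two_ten_holds`, `Kubert1976_no_two_twelve_holds`: the rational points of
`X₁(2,10)` and `X₁(2,12)`), and whose prime-order leaf `Mazur1977_no_prime_torsion` is reduced
(`Mazur1977_no_prime_torsion_holds_of`, `MazurTorsionSplit`) to the single Eisenstein-quotient
statement `Mazur1977_stepThree_eisenstein` (Mazur 1977, Ch. III §5, Step 3).  This file records the
resulting composite reductions, so that Theorem 3 is stated against exactly the named facts that
are still undischarged:

* `ribet1997_twoPowerFermat_of_khare_wintenberger_of_mazur_printed_leaves` — Theorem 3 from
  `khare_wintenberger`, `Mazur1977_no_prime_torsion` (all curves), `MazurTate1973_no_torsion_thirteen`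
  (all curves) and `Mazur1977_reduction_to_primes`;
* **`ribet1997_twoPowerFermat_of_khare_wintenberger_of_mazur_leaves`** — the same with the
  prime-order leaf replaced by `Mazur1977_stepThree_eisenstein`.

No new mathematics: both are one-term compositions of accepted theorems; the point is the
dependency statement (Ribet's Thm. 3 ⟸ Serre's conjecture + Mazur's Step 3 + Mazur–Tate 1973 +
the First reduction).

## References

* [Ribet1997] K. A. Ribet, Acta Arith. 79 (1997), 7–16: Thm. 3, Prop. 1 (p. 11–12), §3.
* [KhareWintenberger2009] C. Khare, J.-P. Wintenberger, Invent. Math. 178 (2009), Thm. 1.2, Thm. 9.1.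
* [Mazur1977] B. Mazur, Publ. Math. IHÉS 47 (1977), Thm. (8) = Ch. III Thm. (5.1); Ch. III §5,
  First reduction (p. 156) and Step 3 (p. 159).
* [MazurTate1973] B. Mazur, J. Tate, Invent. Math. 22 (1973), 41–49.
* [Kubert1976] D. S. Kubert, Proc. London Math. Soc. (3) 33 (1976), 193–237, Ch. IV.
-/

noncomputable section

namespace Literature.NumberTheory.DiophantineGeometry

open EllipticCurves Literature.NumberTheory.Automorphic

/-- **Mazur's torsion theorem for every curve, from its three undischarged printed leaves** (the
two Kubert leaves being the theorems `Kubert1976_no_two_ten_holds`, `Kubert1976_no_two_twelve_holds`).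
[cite: Mazur1977, Ch. III §5, Thm. (5.1) and First reduction, p. 156] -/
theorem forall_mazur_torsion_of_printed_leaves
    (h5 : ∀ V : WeierstrassCurve ℚ, Mazur1977_no_prime_torsion V)
    (h13 : ∀ V : WeierstrassCurve ℚ, MazurTate1973_no_torsion_thirteen V)
    (hK : Mazur1977_reduction_to_primes) (V : WeierstrassCurve ℚ) : mazur_torsion V :=
  mazur_torsion_of_printed_leaves V h5 h13 hK (Kubert1976_no_two_ten_holds V)
    (Kubert1976_no_two_twelve_holds V)

/-- **Mazur's torsion theorem for every curve, from Step 3 (Eisenstein quotient), Mazur–Tate 1973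
and the First reduction.** [cite: Mazur1977, Ch. III §5, Thm. (5.1), First reduction (p. 156), Step 3 (p. 159)] -/
theorem forall_mazur_torsion_of_leaves (hE : Mazur1977_stepThree_eisenstein)
    (h13 : ∀ V : WeierstrassCurve ℚ, MazurTate1973_no_torsion_thirteen V)
    (hK : Mazur1977_reduction_to_primes) (V : WeierstrassCurve ℚ) : mazur_torsion V :=
  forall_mazur_torsion_of_printed_leaves (Mazur1977_no_prime_torsion_holds_of hE) h13 hK V

/-- **Ribet 1997, Theorem 3, from `khare_wintenberger` and the three undischarged PRINTED leaves of
Mazur's torsion theorem.**  For a prime `p ≥ 5` and `2 ≤ α < p`, `xᵖ + 2^α yᵖ + zᵖ = 0` has no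
solution in pairwise coprime non-zero integers — granted Serre's conjecture (`khare_wintenberger`,
packaging Ribet's inputs "Theorem 5" and "[18]"), Mazur's prime-order theorem
`Mazur1977_no_prime_torsion` (Mazur 1977, Ch. III §5), Mazur–Tate 1973 (no rational `13`-torsion)
and Mazur's First reduction `Mazur1977_reduction_to_primes`; the Kubert leaves of `[14]` are
theorems of the tree.  One-term composition of
`ribet1997_twoPowerFermat_of_khare_wintenberger_of_mazur_torsion` (`…MazurTorsionProofs`) with
`forall_mazur_torsion_of_printed_leaves`.
[cite: Ribet1997, Thm. 3, Prop. 1] [cite: KhareWintenberger2009, Thm. 1.2]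
[cite: Mazur1977, Thm 8; Ch. III §5] [cite: MazurTate1973, main theorem] -/
theorem ribet1997_twoPowerFermat_of_khare_wintenberger_of_mazur_printed_leaves
    (hKW : ∀ (p : ℕ) [Fact p.Prime] (k : Type) [Field k] [TopologicalSpace k] [DiscreteTopology k],
      khare_wintenberger p k)
    (h5 : ∀ V : WeierstrassCurve ℚ, Mazur1977_no_prime_torsion V)
    (h13 : ∀ V : WeierstrassCurve ℚ, MazurTate1973_no_torsion_thirteen V)
    (hK : Mazur1977_reduction_to_primes) : ribet1997_twoPowerFermat :=
  ribet1997_twoPowerFermat_of_khare_wintenberger_of_mazur_torsion hKW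
    (forall_mazur_torsion_of_printed_leaves h5 h13 hK)

/-- **Ribet 1997, Theorem 3, from `khare_wintenberger`, Mazur's Step 3, Mazur–Tate 1973 and the
First reduction** — the finest statement of what Theorem 3 still rests on in the tree: Serre's
conjecture (Khare–Wintenberger 2009, Thm. 1.2 / 9.1: modularity and level-lowering of the Frey
representation) and, of Mazur's torsion theorem `[14]`, exactly the Eisenstein-quotient Step 3
(`Mazur1977_stepThree_eisenstein`), the `13`-torsion theorem of Mazur–Tate and the First reduction;
every other input of Ribet's §§2–3 (Frey arithmetic, Tate's algorithm and Ogg's formula at `2`,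
`S₂(Γ₀(8)) = 0`, Néron–Ogg–Shafarevich, the Tate-curve criterion, Serre weight `2`, Prop. 1 in
both cases, Kubert's `X₁(2,10)`, `X₁(2,12)`) is a theorem of the tree.
[cite: Ribet1997, Thm. 3, Prop. 1, §§2–3] [cite: KhareWintenberger2009, Thm. 1.2]
[cite: Mazur1977, Ch. III §5, Step 3 (p. 159), First reduction (p. 156)] [cite: MazurTate1973, main theorem] -/
theorem ribet1997_twoPowerFermat_of_khare_wintenberger_of_mazur_leaves
    (hKW : ∀ (p : ℕ) [Fact p.Prime] (k : Type) [Field k] [TopologicalSpace k] [DiscreteTopology k],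
      khare_wintenberger p k)
    (hE : Mazur1977_stepThree_eisenstein)
    (h13 : ∀ V : WeierstrassCurve ℚ, MazurTate1973_no_torsion_thirteen V)
    (hK : Mazur1977_reduction_to_primes) : ribet1997_twoPowerFermat :=
  ribet1997_twoPowerFermat_of_khare_wintenberger_of_mazur_torsion hKW
    (forall_mazur_torsion_of_leaves hE h13 hK)

end Literature.NumberTheory.DiophantineGeometry

end
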